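import Summits.RiemannHypothesis.RiemannHypothesis.Theorems.PfPersistenceCoefficientRigidityFiniteSites
import Literature.NumberTheory.LFunctions.WeilMellinInversion
import Literature.NumberTheory.LFunctions.WeilArchimedeanPositivityProofs
import HarnessLib

/-!
# Coefficient rigidity of window positivity, VIII-a: the spectral side of the site terms
(pub-rhpf cand-7, gen 9; mechanism/rigidity campaign; no RH claims)

Eighth part of `PfPersistenceCoefficientRigidity`, first half.  For a test function `g` the
autocorrelation `k = g ⋆ g̃` is represented on the critical line by Mellin inversion
(`weilMellin_inversion'`, imported) and `k̂(1/2 + iy) = |ĝ(1/2 + iy)|²` (imported):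
`k(x) = (1/2π) ∫ |ĝ(1/2 + iy)|² e^{-iyx} dy`.  Consequently the site terms of a finitely
supported even perturbation `∑_i c_i (δ_{x_i} + δ_{-x_i})` of `ζ`'s explicit-formula measure are
`∑_i 2c_i Re k(x_i) = (1/2π) ∫ |ĝ(1/2 + iy)|² · 2P(y) dy` with the SYMBOL
`P(y) = ∑_i c_i cos(y x_i)`, and `‖g‖₂² = (1/2π) ∫ |ĝ(1/2 + iy)|² dy`.  Hence (RH-free)
`∑_i 2c_i Re k(x_i) ≥ 2 (inf P) ‖g‖₂²` — the lower half of the symbol criterion of part VIII-b.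
ALL STATEMENTS ARE PROVED (no `sorry`, no new axioms, no RH anywhere in this file); no sentence
is DATA.

* `weilConv_weilReflect_eq_lineIntegral`, `re_weilConv_weilReflect_eq_lineIntegral`,
  `lineIntegral_eq_normSq` (Plancherel on the critical line for test functions).
* `siteSymbol` — `P_{E,c,x}(t) = ∑_{i ∈ E} c_i cos(t x_i)`; `abs_siteSymbol_le`.
* `siteSum_re_eq_lineIntegral` — the site terms through the symbol.
* `siteSum_re_ge_of_le_siteSymbol` — **(RH-free)** `m ≤ P ⇒ 2m‖g‖₂² ≤ ∑_i 2c_i Re k(x_i)`.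

References: E. Bombieri, Rend. Lincei (9) 11 (2000) 183–233, §2 (Mellin inversion);
H. Yoshida, Adv. Stud. Pure Math. 21 (1992), §2 (`F̂ = |φ̂|²`).
-/

set_option linter.dupNamespace false

noncomputable section

open Complex Filter Set MeasureTheory
open scoped Real Topology ComplexConjugate NNReal

namespace Summit.RiemannHypothesis.RiemannHypothesis.Theorems.PfPersistenceCoefficientRigidity

open Literature.NumberTheory.LFunctions
open Literature.NumberTheory.LFunctions.WeilConverse
open Summit.RiemannHypothesis.RiemannHypothesis.Theorems.PfPersistenceDownCone
open Summit.RiemannHypothesis.RiemannHypothesis.Theorems.PfPersistenceBarrier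

/-! ## §38 Plancherel on the critical line for `k = g ⋆ g̃` -/

/-- `y ↦ |ĝ(1/2 + iy)|²` (as a complex-valued function) is integrable: it is the restriction of
`(g ⋆ g̃)^` to the critical line. [this work] -/
theorem integrable_normSq_weilMellin_ofReal {g : ℝ → ℂ} (hg : IsWeilTest g) :
    Integrable fun y : ℝ ↦ ((‖weilMellin g (1 / 2 + y * I)‖ ^ 2 : ℝ) : ℂ) := by
  have hk : IsWeilTest (weilConv g (weilReflect g)) := hg.weilConv hg.weilReflect
  have h := integrable_weilMellin_vertical hk (1 / 2)
  simp_rw [show ((1 / 2 : ℝ) : ℂ) = 1 / 2 by push_cast; ring] at h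
  exact h.congr (Eventually.of_forall fun y ↦ weilMellin_weilConv_weilReflect_half hg y)

/-- `y ↦ |ĝ(1/2 + iy)|²` is integrable. [this work] -/
theorem integrable_normSq_weilMellin {g : ℝ → ℂ} (hg : IsWeilTest g) :
    Integrable fun y : ℝ ↦ ‖weilMellin g (1 / 2 + y * I)‖ ^ 2 :=
  (integrable_normSq_weilMellin_ofReal hg).re.congr
    (Eventually.of_forall fun y ↦ by simp only [RCLike.re_to_complex, Complex.ofReal_re])

/-- `y ↦ |ĝ(1/2 + iy)|² F(y)` is integrable for a continuous bounded real factor `F`.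
[this work] -/
theorem integrable_normSq_weilMellin_mul {g : ℝ → ℂ} (hg : IsWeilTest g) {F : ℝ → ℝ}
    (hF : Continuous F) {B : ℝ} (hB : ∀ y, |F y| ≤ B) :
    Integrable fun y : ℝ ↦ ‖weilMellin g (1 / 2 + y * I)‖ ^ 2 * F y :=
  (integrable_normSq_weilMellin hg).mul_bdd hF.aestronglyMeasurable
    (Eventually.of_forall fun y ↦ by rw [Real.norm_eq_abs]; exact hB y)

/-- **Plancherel on the critical line**: `(g ⋆ g̃)(x) = (1/2π) ∫ |ĝ(1/2 + iy)|² e^{-iyx} dy`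
(Mellin inversion for the test function `g ⋆ g̃` at `c = 1/2`). [this work] -/
theorem weilConv_weilReflect_eq_lineIntegral {g : ℝ → ℂ} (hg : IsWeilTest g) (x : ℝ) :
    weilConv g (weilReflect g) x = ((1 / (2 * π) : ℝ) : ℂ) *
      ∫ y : ℝ, ((‖weilMellin g (1 / 2 + y * I)‖ ^ 2 : ℝ) : ℂ) * cexp (((-(y * x) : ℝ) : ℂ) * I) := by
  have hk : IsWeilTest (weilConv g (weilReflect g)) := hg.weilConv hg.weilReflect
  have h := weilMellin_inversion' hk (1 / 2) x
  simp_rw [show ((1 / 2 : ℝ) : ℂ) = 1 / 2 by push_cast; ring, sub_self, zero_add,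
    weilMellin_weilConv_weilReflect_half hg] at h
  have e : ∀ y : ℝ, cexp (-((y : ℂ) * I) * (x : ℂ)) = cexp (((-(y * x) : ℝ) : ℂ) * I) := fun y ↦ by
    congr 1
    push_cast
    ring
  simp_rw [e] at h
  rw [h]
  have hπ : (π : ℂ) ≠ 0 := Complex.ofReal_ne_zero.2 Real.pi_ne_zero
  push_cast
  field_simp

/-- Real part: `Re (g ⋆ g̃)(x) = (1/2π) ∫ |ĝ(1/2 + iy)|² cos(yx) dy`. [this work] -/
theorem re_weilConv_weilReflect_eq_lineIntegral {g : ℝ → ℂ} (hg : IsWeilTest g) (x : ℝ) :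
    (weilConv g (weilReflect g) x).re =
      1 / (2 * π) * ∫ y : ℝ, ‖weilMellin g (1 / 2 + y * I)‖ ^ 2 * Real.cos (y * x) := by
  have hint : Integrable fun y : ℝ ↦
      ((‖weilMellin g (1 / 2 + y * I)‖ ^ 2 : ℝ) : ℂ) * cexp (((-(y * x) : ℝ) : ℂ) * I) :=
    (integrable_normSq_weilMellin_ofReal hg).mul_bdd (by fun_prop)
      (Eventually.of_forall fun y ↦ by rw [Complex.norm_exp_ofReal_mul_I])
  rw [weilConv_weilReflect_eq_lineIntegral hg x, Complex.re_ofReal_mul]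
  congr 1
  rw [show (∫ y : ℝ, ((‖weilMellin g (1 / 2 + y * I)‖ ^ 2 : ℝ) : ℂ) *
      cexp (((-(y * x) : ℝ) : ℂ) * I)).re = RCLike.re (∫ y : ℝ,
        ((‖weilMellin g (1 / 2 + y * I)‖ ^ 2 : ℝ) : ℂ) * cexp (((-(y * x) : ℝ) : ℂ) * I)) from rfl,
    ← integral_re hint]
  refine integral_congr_ae (Eventually.of_forall fun y ↦ ?_)
  simp only [RCLike.re_to_complex, Complex.re_ofReal_mul, Complex.exp_ofReal_mul_I_re,
    Real.cos_neg]

/-- `‖g‖₂² = (1/2π) ∫ |ĝ(1/2 + iy)|² dy` (the case `x = 0`). [this work] -/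
theorem lineIntegral_eq_normSq {g : ℝ → ℂ} (hg : IsWeilTest g) :
    1 / (2 * π) * ∫ y : ℝ, ‖weilMellin g (1 / 2 + y * I)‖ ^ 2 = ∫ u, ‖g u‖ ^ 2 := by
  have h := re_weilConv_weilReflect_eq_lineIntegral hg 0
  simp_rw [mul_zero, Real.cos_zero, mul_one] at h
  rw [← h, weilConv_weilReflect_apply_zero, Complex.ofReal_re]

/-! ## §39 The symbol of a finitely supported even perturbation -/

/-- The SYMBOL (cosine transform) of the even measure `∑_{i ∈ E} c_i (δ_{x_i} + δ_{-x_i})/2…`,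
normalised as `P(t) = ∑_{i ∈ E} c_i cos(t x_i)`. [this work] -/
def siteSymbol {ι : Type*} (E : Finset ι) (c x : ι → ℝ) (t : ℝ) : ℝ :=
  ∑ i ∈ E, c i * Real.cos (t * x i)

/-- `|P(t)| ≤ ∑ |c_i|`. [this work] -/
theorem abs_siteSymbol_le {ι : Type*} (E : Finset ι) (c x : ι → ℝ) (t : ℝ) :
    |siteSymbol E c x t| ≤ ∑ i ∈ E, |c i| := by
  refine (Finset.abs_sum_le_sum_abs _ _).trans (Finset.sum_le_sum fun i _ ↦ ?_)
  rw [abs_mul]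
  exact mul_le_of_le_one_right (abs_nonneg _) (Real.abs_cos_le_one _)

/-- `P` is continuous. [this work] -/
theorem continuous_siteSymbol {ι : Type*} (E : Finset ι) (c x : ι → ℝ) :
    Continuous (siteSymbol E c x) := by
  unfold siteSymbol
  fun_prop

/-- `P` is bounded below (by `-∑ |c_i|`). [this work] -/
theorem bddBelow_range_siteSymbol {ι : Type*} (E : Finset ι) (c x : ι → ℝ) :
    BddBelow (Set.range (siteSymbol E c x)) := by
  refine ⟨-∑ i ∈ E, |c i|, ?_⟩
  rintro _ ⟨t, rfl⟩
  have h1 := neg_abs_le (siteSymbol E c x t)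
  have h2 := abs_siteSymbol_le E c x t
  linarith

/-- **The site terms through the symbol**:
`∑_i 2c_i Re (g ⋆ g̃)(x_i) = (1/2π) ∫ |ĝ(1/2 + iy)|² · 2P(y) dy`. [this work] -/
theorem siteSum_re_eq_lineIntegral {g : ℝ → ℂ} (hg : IsWeilTest g) {ι : Type*} (E : Finset ι)
    (c x : ι → ℝ) :
    ∑ i ∈ E, 2 * c i * (weilConv g (weilReflect g) (x i)).re =
      1 / (2 * π) * ∫ y : ℝ, ‖weilMellin g (1 / 2 + y * I)‖ ^ 2 * (2 * siteSymbol E c x y) := by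
  simp_rw [re_weilConv_weilReflect_eq_lineIntegral hg]
  have hi : ∀ i ∈ E, Integrable fun y : ℝ ↦
      2 * c i * (‖weilMellin g (1 / 2 + y * I)‖ ^ 2 * Real.cos (y * x i)) := fun i _ ↦
    (integrable_normSq_weilMellin_mul hg (F := fun y ↦ Real.cos (y * x i)) (by fun_prop)
      (fun y ↦ Real.abs_cos_le_one _)).const_mul _
  have e : ∀ y : ℝ, ‖weilMellin g (1 / 2 + y * I)‖ ^ 2 * (2 * siteSymbol E c x y) =
      ∑ i ∈ E, 2 * c i * (‖weilMellin g (1 / 2 + y * I)‖ ^ 2 * Real.cos (y * x i)) := by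
    intro y
    rw [siteSymbol, Finset.mul_sum, Finset.mul_sum]
    exact Finset.sum_congr rfl fun i _ ↦ by ring
  simp_rw [e]
  rw [integral_finsetSum _ hi, Finset.mul_sum]
  refine Finset.sum_congr rfl fun i _ ↦ ?_
  rw [integral_const_mul]
  ring

/-- **Lower bound through the symbol (RH-free).**  If `m ≤ P(t)` for all `t` then
`2m ‖g‖₂² ≤ ∑_i 2c_i Re (g ⋆ g̃)(x_i)` for every test function `g`. [this work] -/
theorem siteSum_re_ge_of_le_siteSymbol {g : ℝ → ℂ} (hg : IsWeilTest g) {ι : Type*}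
    {E : Finset ι} {c x : ι → ℝ} {m : ℝ} (hm : ∀ t, m ≤ siteSymbol E c x t) :
    2 * m * ∫ u, ‖g u‖ ^ 2 ≤ ∑ i ∈ E, 2 * c i * (weilConv g (weilReflect g) (x i)).re := by
  rw [siteSum_re_eq_lineIntegral hg, ← lineIntegral_eq_normSq hg]
  have hD := integrable_normSq_weilMellin hg
  have hDP : Integrable fun y : ℝ ↦ ‖weilMellin g (1 / 2 + y * I)‖ ^ 2 * (2 * siteSymbol E c x y) :=
    integrable_normSq_weilMellin_mul hg (continuous_const.mul (continuous_siteSymbol E c x))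
      (B := 2 * ∑ i ∈ E, |c i|) fun y ↦ by
        rw [abs_mul, abs_two]
        exact mul_le_mul_of_nonneg_left (abs_siteSymbol_le E c x y) zero_le_two
  rw [show 2 * m * (1 / (2 * π) * ∫ y : ℝ, ‖weilMellin g (1 / 2 + y * I)‖ ^ 2) =
      1 / (2 * π) * ∫ y : ℝ, ‖weilMellin g (1 / 2 + y * I)‖ ^ 2 * (2 * m) by
    rw [integral_mul_const]; ring]
  refine mul_le_mul_of_nonneg_left (integral_mono (hD.mul_const _) hDP fun y ↦ ?_) (by positivity)
  exact mul_le_mul_of_nonneg_left (by linarith [hm y]) (sq_nonneg _)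

/-- In terms of the multi-site functional: `Re Q_{E,c,x}(g) ≥ Re W(g ⋆ g̃) + 2m‖g‖₂²`
whenever `m ≤ P`. [this work] -/
theorem multiSiteQuadratic_re_ge_of_le_siteSymbol {g : ℝ → ℂ} (hg : IsWeilTest g) {ι : Type*}
    {E : Finset ι} {c x : ι → ℝ} {m : ℝ} (hm : ∀ t, m ≤ siteSymbol E c x t) :
    (weilQuadratic g).re + 2 * m * ∫ u, ‖g u‖ ^ 2 ≤ (multiSiteQuadratic E c x g).re := by
  rw [multiSiteQuadratic_re]
  linarith [siteSum_re_ge_of_le_siteSymbol hg hm]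

end Summit.RiemannHypothesis.RiemannHypothesis.Theorems.PfPersistenceCoefficientRigidity

end
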